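import Mathlib
import Summits.CriticalPhenomena.CardyFormulaZ2.Theorems.CardyFlipRussoSquareFromVoronoiHubDefs
import Summits.CriticalPhenomena.CardyFormulaZ2.Theorems.CardyFlipRussoSquareFromVoronoiHubSmallCellsPart1
import Summits.CriticalPhenomena.CardyFormulaZ2.Theorems.CardyFlipRussoSquareFromVoronoiHubChessboardDefs
import Literature.Probability.Percolation.VoronoiCrossing
import Literature.Analysis.FunctionSpaces.PoissonPointProcess
import Literature.Analysis.FunctionSpaces.PoissonPointProcessExistence
import Literature.Analysis.FunctionSpaces.PoissonPointProcessUniqueness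
import HarnessLib

/-!
# Stub `stub_densityWhp` of line `Sketch` (r2 k4, card `poissonised-chessboard`), crux
# `SquareFromVoronoiHub` (stmt-CriticalPhenomena-6434): Poisson void/density estimates at `u = 1`

The probabilistic input of the chessboard endpoint of the leg (`…ChessboardDefs`): at `u = 1` the
free nuclei have intensity `0`, the block-type nuclei are Poisson of intensity `2 · vol` (nucleus
units) and the coins are fair and independent (`legMeasure`).  For every bounded window `V`, with
probability `→ 1` as `δ → 0⁺`: no free nucleus is present, every point of `V` has a block-type
nucleus within plane distance `δ/16` (nuclei read at scale `s(δ) = δ/m(δ)`), and some block-type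
nucleus has a black coin and some a white coin (`stub_densityWhp`, via the union bound `real_bad_le`
over rectangles of the product law: void probabilities of `O(δ⁻²)` discs of radius `m(δ)/64`, each
`e^{-2π(m/64)²} ≤ δ³` eventually since `m(δ) = max 1 (log δ)²`, and `2^{-N}`, `N ≍ 1/δ`, for the
prescribed coins; the octagon of the cut-corner `4.8.8` partition contains the sup-ball of radius
`1/4` about its centre, `blk_eq_inl_of_dist_lt`).  References: J. F. C. Kingman, *Poisson Processes*
(1993), §2.1 (void probabilities); B. Bollobás, O. Riordan, *Percolation* (2006), Ch. 8 §8.2;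
G. Grimmett, *Percolation* (1999), §1.6 (site percolation, cylinder probabilities).
-/

noncomputable section

open scoped Topology
open Filter Set MeasureTheory Metric
open Literature.Analysis.FunctionSpaces (PointConfig IsPoissonPointProcess)
open Literature.Probability.Percolation (SiteConfig sitePercolation half)
open Summit.CriticalPhenomena.CardyFormulaZ2.Cruxes.SquareFromVoronoiHub.VoronoiBlocks.SmallCells
  (count_ne_zero_iff count_univ_eq_zero_iff volume_real_ball volume_ball_ne_top)

namespace Summit.CriticalPhenomena.CardyFormulaZ2.Cruxes.SquareFromVoronoiHub.PoissonisedChessboard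

/-! ### Geometry: octagon blocks contain the sup-ball of radius `1/4` about their centre -/

/-- A point within sup-distance `1/4` of the lattice point `(i, j)` lies in the octagon block
`Sum.inl (i, j)` of the unit-mesh `4.8.8` partition: the diamond test fails (the fractional parts
are more than `1/4` from `1/2`) and the coordinates round to `(i, j)`. [folklore] -/
theorem blkUnit_eq_inl {w : ℂ} {i j : ℤ} (hre : |w.re - i| < 1 / 4) (him : |w.im - j| < 1 / 4) :
    blkUnit w = Sum.inl (i, j) := by
  have hround : ∀ {r : ℝ} {k : ℤ}, |r - k| < 1 / 4 → round r = k := fun h => by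
    obtain ⟨h1, h2⟩ := abs_lt.mp h
    rw [round_eq, Int.floor_eq_iff]
    constructor <;> linarith
  have hfract : 1 / 4 < |Int.fract w.re - 1 / 2| := by
    rw [Int.fract]
    obtain ⟨h1, h2⟩ := abs_lt.mp hre
    rcases le_or_gt i ⌊w.re⌋ with hle | hlt
    · have hle' : (i : ℝ) ≤ ⌊w.re⌋ := by exact_mod_cast hle
      rw [abs_of_neg (by linarith)]
      linarith
    · have hlt' : (⌊w.re⌋ : ℝ) + 1 ≤ i := by exact_mod_cast hlt
      have hfl : w.re < ⌊w.re⌋ + 1 := Int.lt_floor_add_one w.re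
      rw [abs_of_pos (by linarith)]
      linarith
  rw [blkUnit, if_neg (by intro h3; linarith [abs_nonneg (Int.fract w.im - 1 / 2)]), hround hre,
    hround him]

/-- At block side `m > 0`, a nucleus within distance `r ≤ m/4` of the block centre `m · (i + j I)`
lies in the octagon block `Sum.inl (i, j)`. [folklore] -/
theorem blk_eq_inl_of_dist_lt {m : ℝ} (hm : 0 < m) {x : ℂ} {i j : ℤ} {r : ℝ} (hr : r ≤ m / 4)
    (hx : dist x ((m : ℂ) * ((i : ℂ) + (j : ℂ) * Complex.I)) < r) : blk m x = Sum.inl (i, j) := by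
  unfold blk
  set c : ℂ := (i : ℂ) + (j : ℂ) * Complex.I with hc
  have hmC : (m : ℂ) ≠ 0 := Complex.ofReal_ne_zero.mpr hm.ne'
  have hxw : x = (m : ℂ) * (x / (m : ℂ)) := by field_simp
  have hdist : ‖x / (m : ℂ) - c‖ < 1 / 4 := by
    rw [hxw, Complex.dist_eq, ← mul_sub, norm_mul, Complex.norm_real, Real.norm_eq_abs,
      abs_of_pos hm] at hx
    have h4 : m * ‖x / (m : ℂ) - c‖ < m * (1 / 4) := by linarith
    exact lt_of_mul_lt_mul_left h4 hm.le
  have hre : |(x / (m : ℂ)).re - i| < 1 / 4 := by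
    refine lt_of_le_of_lt ?_ hdist
    simpa [hc] using Complex.abs_re_le_norm (x / (m : ℂ) - c)
  have him : |(x / (m : ℂ)).im - j| < 1 / 4 := by
    refine lt_of_le_of_lt ?_ hdist
    simpa [hc] using Complex.abs_im_le_norm (x / (m : ℂ) - c)
  exact blkUnit_eq_inl hre him

/-- Every point is within `h` of the grid point `h · (round (re/h) + round (im/h) I)` (`h > 0`):
each coordinate is off by at most `h/2`. [folklore] -/
theorem dist_grid_round_le {h : ℝ} (hh : 0 < h) (z : ℂ) :
    dist z ((h : ℂ) * (((round (z.re / h) : ℤ) : ℂ) + ((round (z.im / h) : ℤ) : ℂ) * Complex.I))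
      ≤ h := by
  have hco : ∀ t : ℝ, |t - h * round (t / h)| ≤ h / 2 := fun t => by
    rw [show t - h * round (t / h) = h * (t / h - round (t / h)) by field_simp, abs_mul,
      abs_of_pos hh]
    nlinarith [abs_sub_round (t / h)]
  rw [Complex.dist_eq]
  refine (Complex.norm_le_abs_re_add_abs_im _).trans ?_
  simpa using add_le_add (hco z.re) (hco z.im)

/-! ### Probabilistic inputs: void probabilities, coins, and the product structure -/

/-- **Union bound for voids** under the Poisson law of intensity `2 · vol`: the probability that
one of the discs `B(t, ρ)`, `t ∈ T`, contains no point is at most `|T| · e^{-2πρ²}`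
(Kingman 1993, §2.1). [folklore] -/
theorem measureReal_exists_void_le {PK : Measure (PointConfig ℂ)} {ρ : ℝ} (hρ : 0 ≤ ρ)
    (hK : IsPoissonPointProcess ((2 : ENNReal) • (volume : Measure ℂ)) PK) (T : Finset ℂ) :
    PK.real {c | ∃ t ∈ T, c.count (ball t ρ) = 0} ≤ T.card * Real.exp (-(2 * Real.pi * ρ ^ 2)) := by
  have hset : {c : PointConfig ℂ | ∃ t ∈ T, c.count (ball t ρ) = 0} =
      ⋃ t ∈ T, {c | c.count (ball t ρ) = 0} := by
    ext c; simp
  rw [hset]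
  refine (measureReal_biUnion_finset_le T _).trans ?_
  have hvoid : ∀ t ∈ T, PK.real {c : PointConfig ℂ | c.count (ball t ρ) = 0} =
      Real.exp (-(2 * Real.pi * ρ ^ 2)) := by
    intro t _
    have hν : ((2 : ENNReal) • (volume : Measure ℂ)) (ball t ρ) ≠ ⊤ := by
      rw [Measure.smul_apply, smul_eq_mul]
      exact ENNReal.mul_ne_top (by norm_num) (volume_ball_ne_top t ρ)
    rw [hK.measureReal_count_eq_zero measurableSet_ball hν, Measure.smul_apply, smul_eq_mul,
      ENNReal.toReal_mul, ← measureReal_def, volume_real_ball t hρ]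
    norm_num
    ring
  rw [Finset.sum_congr rfl hvoid, Finset.sum_const, nsmul_eq_mul]

/-- Under the Poisson law of intensity `0` the configuration is almost surely empty:
`P {N(univ) = 0}ᶜ = 0` (the void probability of `univ` is `e^0 = 1`). [folklore] -/
theorem measureReal_count_univ_ne_zero {P : Measure (PointConfig ℂ)}
    (hP : IsPoissonPointProcess (0 : Measure ℂ) P) :
    P.real {c | c.count univ = 0}ᶜ = 0 := by
  haveI := hP.isProbabilityMeasure
  have hmeas : MeasurableSet {c : PointConfig ℂ | c.count univ = 0} :=
    (PointConfig.measurable_count MeasurableSet.univ) (measurableSet_singleton _)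
  have h1 : P {c : PointConfig ℂ | c.count univ = 0} = 1 := by
    rw [hP.measure_count_eq_zero MeasurableSet.univ (by simp)]
    simp
  rw [measureReal_def, (prob_compl_eq_zero_iff hmeas).mpr h1, ENNReal.toReal_zero]

/-- Fair coins: the probability that all coins of the finite set `F` are white is `2^{-|F|}`
(Grimmett 1999, §1.6). [folklore] -/
theorem sitePercolation_half_real_forall_notMem {W : Type*} (F : Finset W) :
    (sitePercolation W half).real {ω | ∀ v ∈ F, v ∉ ω} = (1 / 2 : ℝ) ^ F.card := by
  rw [measureReal_def, Literature.Probability.Percolation.sitePercolation_apply']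
  have : ((fun χ : W → Prop => {v | χ v}) ⁻¹' {ω : SiteConfig W | ∀ v ∈ F, v ∉ ω}) =
      Set.pi ↑F fun _ => {False} := by
    ext χ; simp [Set.mem_pi]
  rw [this, Literature.Probability.Percolation.sitePi,
    Measure.infinitePi_pi _ (fun _ _ => measurableSet_singleton _), Finset.prod_const,
    ENNReal.toReal_pow, ← measureReal_def,
    Literature.Probability.Percolation.bernoulliProp_real_false]
  norm_num

/-- **Rectangles of the leg law**: `legMeasure` of a product event is the product of the four
marginal probabilities (`Measure.prod_prod`, no measurability needed). [folklore] -/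
theorem legMeasure_real_prod {PBf PWf PK : Measure (PointConfig ℂ)} [SFinite PWf] [SFinite PK]
    (A B C : Set (PointConfig ℂ)) (D : Set (SiteConfig ((ℤ × ℤ) ⊕ (ℤ × ℤ)))) :
    (legMeasure PBf PWf PK).real (((A ×ˢ B) ×ˢ C) ×ˢ D) =
      PBf.real A * PWf.real B * PK.real C * (sitePercolation ((ℤ × ℤ) ⊕ (ℤ × ℤ)) half).real D := by
  simp only [measureReal_def, legMeasure, Measure.prod_prod, ENNReal.toReal_mul]

/-- Union bound for five events, two null and two of equal probability. [folklore] -/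
theorem measureReal_union₅_le {α : Type*} [MeasurableSpace α] {μ : Measure α}
    {P₁ P₂ P₃ P₄ P₅ : Set α} {a b : ℝ} (h₁ : μ.real P₁ = 0) (h₂ : μ.real P₂ = 0)
    (h₃ : μ.real P₃ ≤ a) (h₄ : μ.real P₄ = b) (h₅ : μ.real P₅ = b) :
    μ.real (P₁ ∪ P₂ ∪ P₃ ∪ P₄ ∪ P₅) ≤ a + 2 * b := by
  have := measureReal_union_le (μ := μ) (P₁ ∪ P₂ ∪ P₃ ∪ P₄) P₅
  have := measureReal_union_le (μ := μ) (P₁ ∪ P₂ ∪ P₃) P₄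
  have := measureReal_union_le (μ := μ) (P₁ ∪ P₂) P₃
  have := measureReal_union_le (μ := μ) P₁ P₂
  linarith

/-- Eventually (as `δ → 0⁺`) `e^{-2π (m(δ)/64)²} ≤ δ³`: indeed `m(δ) ≥ (log δ)²`, and
`π (log δ)⁴ / 2048 ≥ 3 |log δ|` once `|log δ| ≥ 13`. [folklore] -/
theorem eventually_exp_mOf_le_cube :
    ∀ᶠ δ in 𝓝[>] (0 : ℝ), Real.exp (-(2 * Real.pi * (mOf δ / 64) ^ 2)) ≤ δ ^ 3 := by
  filter_upwards [Ioo_mem_nhdsGT (Real.exp_pos (-13))] with δ hδ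
  obtain ⟨hδ0, hδ1⟩ := hδ
  have hl : Real.log δ < -13 := by simpa using Real.log_lt_log hδ0 hδ1
  rw [show δ ^ 3 = Real.exp (3 * Real.log δ) by
    rw [show (3 : ℝ) * Real.log δ = Real.log (δ ^ 3) by rw [Real.log_pow]; norm_num,
      Real.exp_log (pow_pos hδ0 3)], Real.exp_le_exp]
  have hm2 : (Real.log δ ^ 2) ^ 2 ≤ mOf δ ^ 2 := pow_le_pow_left₀ (sq_nonneg _) (le_max_right _ _) 2
  have hpi : 3 * mOf δ ^ 2 ≤ Real.pi * mOf δ ^ 2 :=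
    mul_le_mul_of_nonneg_right Real.pi_gt_three.le (sq_nonneg _)
  have hu : 2048 * (-Real.log δ) ≤ (Real.log δ ^ 2) ^ 2 := by
    obtain ⟨u, hu⟩ : ∃ u : ℝ, u = -Real.log δ := ⟨_, rfl⟩
    rw [show Real.log δ = -u by linarith, neg_neg, show ((-u) ^ 2) ^ 2 = u * u ^ 3 by ring]
    have h2 : 169 < u ^ 2 := by nlinarith
    have h3 : 2197 < u ^ 3 := by nlinarith
    nlinarith [mul_le_mul_of_nonneg_left h3.le (by linarith : (0 : ℝ) ≤ u)]
  linarith [show 2 * Real.pi * (mOf δ / 64) ^ 2 = Real.pi * mOf δ ^ 2 / 2048 by ring]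

/-- **The quantitative bound at mesh `δ > 0`.** For `V ⊆ B̄(0, Rad)` and `N ≥ 64 Rad/δ + 1/2` the
bad event has probability `≤ 2(2N+1)² e^{-2π (m/64)²} + 2 · 2^{-N}` (`m = m(δ)`): free nuclei are
a.s. absent; once the `(2N+1)²` grid discs of radius `m/64` about `(m/64)(i + jI)`, `|i|, |j| ≤ N`,
and the `N` discs about the block centres `m·(i,0)`, `i < N`, are occupied, `V` is `δ/32`-dense in
plane nuclei and the blocks `Sum.inl (i,0)` have nuclei; their coins are all white, resp. all
black, with probability `2^{-N}`. [folklore] -/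
theorem real_bad_le {PBf PWf PK : Measure (PointConfig ℂ)}
    (hBf : IsPoissonPointProcess (0 : Measure ℂ) PBf)
    (hWf : IsPoissonPointProcess (0 : Measure ℂ) PWf)
    (hK : IsPoissonPointProcess ((2 : ENNReal) • (volume : Measure ℂ)) PK)
    {V : Set ℂ} {Rad δ : ℝ} {N : ℕ} (hV : V ⊆ closedBall 0 Rad) (hδ : 0 < δ)
    (hN : Rad / (δ / 64) + 1 / 2 ≤ N) :
    (legMeasure PBf PWf PK).real {ω | ¬ ((ω.1.1.1 : Set ℂ) = ∅ ∧ (ω.1.1.2 : Set ℂ) = ∅ ∧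
        (∀ z ∈ V, ∃ x ∈ (ω.1.2 : Set ℂ), dist z ((sOf δ : ℂ) * x) < δ / 16) ∧
        (∃ x ∈ (ω.1.2 : Set ℂ), blk (mOf δ) x ∈ ω.2) ∧
        (∃ x ∈ (ω.1.2 : Set ℂ), blk (mOf δ) x ∉ ω.2))}
      ≤ ((2 * (2 * N + 1) ^ 2 : ℕ) : ℝ) * Real.exp (-(2 * Real.pi * (mOf δ / 64) ^ 2)) +
        2 * (1 / 2 : ℝ) ^ N := by
  haveI := hBf.isProbabilityMeasure
  haveI := hWf.isProbabilityMeasure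
  haveI := hK.isProbabilityMeasure
  haveI : IsProbabilityMeasure (legMeasure PBf PWf PK) := by unfold legMeasure; infer_instance
  obtain ⟨ρ, hρ⟩ : ∃ ρ : ℝ, ρ = mOf δ / 64 := ⟨_, rfl⟩
  rw [← hρ]
  have hm0 : 0 < mOf δ := mOf_pos δ
  have hρ0 : 0 ≤ ρ := by rw [hρ]; positivity
  have hρ4 : ρ ≤ mOf δ / 4 := by rw [hρ]; linarith
  have hsρ : sOf δ * ρ = δ / 64 := by rw [hρ, mul_div_assoc', sOf_mul_mOf]
  -- the index sets: grid centres, block centres, prescribed blocks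
  obtain ⟨I, hI⟩ : ∃ I : Finset (ℤ × ℤ), I = Finset.Icc (-(N : ℤ)) N ×ˢ Finset.Icc (-(N : ℤ)) N :=
    ⟨_, rfl⟩
  obtain ⟨T, hT⟩ : ∃ T : Finset ℂ, T = (I.image fun p => (ρ : ℂ) * ((p.1 : ℂ) + (p.2 : ℂ) *
      Complex.I)) ∪ (Finset.range N).image fun i : ℕ => (mOf δ : ℂ) * (((i : ℤ) : ℂ) +
        ((0 : ℤ) : ℂ) * Complex.I) := ⟨_, rfl⟩
  obtain ⟨F, hF⟩ : ∃ F : Finset ((ℤ × ℤ) ⊕ (ℤ × ℤ)), F = (Finset.range N).image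
      fun i : ℕ => (Sum.inl ((i : ℤ), (0 : ℤ)) : (ℤ × ℤ) ⊕ (ℤ × ℤ)) := ⟨_, rfl⟩
  -- the probabilities of the five rectangles
  have hA : (legMeasure PBf PWf PK).real ((({c : PointConfig ℂ | c.count univ = 0}ᶜ ×ˢ univ) ×ˢ
      univ) ×ˢ univ) = 0 := by
    simp [legMeasure_real_prod, measureReal_count_univ_ne_zero hBf]
  have hB : (legMeasure PBf PWf PK).real (((univ ×ˢ {c : PointConfig ℂ | c.count univ = 0}ᶜ) ×ˢ
      univ) ×ˢ univ) = 0 := by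
    simp [legMeasure_real_prod, measureReal_count_univ_ne_zero hWf]
  have hTc : T.card ≤ 2 * (2 * N + 1) ^ 2 := by
    have hIc : I.card = (2 * N + 1) * (2 * N + 1) := by
      rw [hI, Finset.card_product, Int.card_Icc, show ((N : ℤ) + 1 - -(N : ℤ)).toNat = 2 * N + 1 by
        omega]
    rw [hT]
    refine (Finset.card_union_le _ _).trans ((add_le_add Finset.card_image_le
      Finset.card_image_le).trans ?_)
    rw [hIc, Finset.card_range]
    nlinarith
  have hC : (legMeasure PBf PWf PK).real (((univ ×ˢ univ) ×ˢ
      {c | ∃ t ∈ T, c.count (ball t ρ) = 0}) ×ˢ univ) ≤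
      ((2 * (2 * N + 1) ^ 2 : ℕ) : ℝ) * Real.exp (-(2 * Real.pi * ρ ^ 2)) := by
    rw [legMeasure_real_prod]
    simp only [probReal_univ, one_mul, mul_one]
    refine (measureReal_exists_void_le hρ0 hK T).trans ?_
    exact mul_le_mul_of_nonneg_right (by exact_mod_cast hTc) (Real.exp_nonneg _)
  have hFc : F.card = N := by
    rw [hF, Finset.card_image_of_injective _ (fun a b h => by simpa using h), Finset.card_range]
  have hD : (legMeasure PBf PWf PK).real (((univ ×ˢ univ) ×ˢ univ) ×ˢ {c | ∀ v ∈ F, v ∉ c}) =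
      (1 / 2 : ℝ) ^ N := by
    rw [legMeasure_real_prod, sitePercolation_half_real_forall_notMem, hFc]
    simp
  have hE : (legMeasure PBf PWf PK).real (((univ ×ˢ univ) ×ˢ univ) ×ˢ
      {c | (↑F : Set ((ℤ × ℤ) ⊕ (ℤ × ℤ))) ⊆ c}) = (1 / 2 : ℝ) ^ N := by
    rw [legMeasure_real_prod, Literature.Probability.Percolation.sitePercolation_real_subset,
      Literature.Probability.Percolation.coe_half, hFc]
    simp
  -- the bad event lies in the union of the five rectangles
  refine (measureReal_mono ?_).trans (measureReal_union₅_le hA hB hC hD hE)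
  intro ω hω
  by_contra hc
  simp only [Set.mem_union, Set.mem_prod, Set.mem_univ, and_true, true_and, Set.mem_compl_iff,
    Set.mem_setOf_eq, not_or, not_not, not_exists, not_and, not_forall, Set.not_subset,
    Finset.mem_coe, exists_prop] at hc
  obtain ⟨⟨⟨⟨hA', hB'⟩, hVd⟩, hC0⟩, hC1⟩ := hc
  -- an occupied disc about a block centre provides a nucleus of that block
  have hblk : ∀ i ∈ Finset.range N, ∃ x ∈ (ω.1.2 : Set ℂ),
      blk (mOf δ) x = Sum.inl ((i : ℤ), (0 : ℤ)) := by
    intro i hi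
    have ht : (mOf δ : ℂ) * (((i : ℤ) : ℂ) + ((0 : ℤ) : ℂ) * Complex.I) ∈ T := by
      rw [hT]
      exact Finset.mem_union_right _ (Finset.mem_image_of_mem _ hi)
    obtain ⟨x, hxK, hxB⟩ := (count_ne_zero_iff _ _).mp (hVd _ ht)
    exact ⟨x, hxK, blk_eq_inl_of_dist_lt hm0 hρ4 (mem_ball.mp hxB)⟩
  refine hω ⟨(count_univ_eq_zero_iff _).mp hA', (count_univ_eq_zero_iff _).mp hB', ?_, ?_, ?_⟩
  · -- density: the grid disc nearest to `z` is occupied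
    intro z hz
    have hzR : ‖z‖ ≤ Rad := mem_closedBall_zero_iff.mp (hV hz)
    have h64 : (0 : ℝ) < δ / 64 := by positivity
    have hround : ∀ {t : ℝ}, |t| ≤ ‖z‖ → round (t / (δ / 64)) ∈ Finset.Icc (-(N : ℤ)) N := by
      intro t ht
      have h1 : |t / (δ / 64) - round (t / (δ / 64))| ≤ 1 / 2 := abs_sub_round _
      have h2 : |t / (δ / 64)| ≤ Rad / (δ / 64) := by
        rw [abs_div, abs_of_pos h64]; exact div_le_div_of_nonneg_right (ht.trans hzR) h64.le
      have h3 := abs_sub_abs_le_abs_sub ((round (t / (δ / 64)) : ℤ) : ℝ) (t / (δ / 64))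
      rw [abs_sub_comm] at h3
      rw [Finset.mem_Icc, ← abs_le, ← Int.cast_le (R := ℝ), Int.cast_abs, Int.cast_natCast]
      linarith
    obtain ⟨i, hi⟩ : ∃ i : ℤ, i = round (z.re / (δ / 64)) := ⟨_, rfl⟩
    obtain ⟨j, hj⟩ : ∃ j : ℤ, j = round (z.im / (δ / 64)) := ⟨_, rfl⟩
    have hpI : (i, j) ∈ I := by
      rw [hI, hi, hj]
      exact Finset.mem_product.mpr ⟨hround (Complex.abs_re_le_norm z),
        hround (Complex.abs_im_le_norm z)⟩
    have ht : (ρ : ℂ) * ((i : ℂ) + (j : ℂ) * Complex.I) ∈ T := by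
      rw [hT]
      exact Finset.mem_union_left _ (Finset.mem_image.mpr ⟨(i, j), hpI, rfl⟩)
    obtain ⟨x, hxK, hxB⟩ := (count_ne_zero_iff _ _).mp (hVd _ ht)
    refine ⟨x, hxK, ?_⟩
    have hgrid := dist_grid_round_le h64 z
    rw [← hi, ← hj, show ((δ / 64 : ℝ) : ℂ) * ((i : ℂ) + (j : ℂ) * Complex.I) =
      (sOf δ : ℂ) * ((ρ : ℂ) * ((i : ℂ) + (j : ℂ) * Complex.I)) by
        rw [← mul_assoc, ← Complex.ofReal_mul, hsρ]] at hgrid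
    have h2 : dist ((sOf δ : ℂ) * ((ρ : ℂ) * ((i : ℂ) + (j : ℂ) * Complex.I))) ((sOf δ : ℂ) * x)
        < δ / 64 := by
      rw [Complex.dist_eq, ← mul_sub, norm_mul, Complex.norm_real, Real.norm_eq_abs,
        abs_of_pos (sOf_pos hδ), ← hsρ]
      refine mul_lt_mul_of_pos_left ?_ (sOf_pos hδ)
      rw [← Complex.dist_eq, dist_comm]
      exact mem_ball.mp hxB
    exact (dist_triangle z ((sOf δ : ℂ) * ((ρ : ℂ) * ((i : ℂ) + (j : ℂ) * Complex.I))) _).trans_lt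
      (by linarith)
  · -- a block-type nucleus with a black coin
    obtain ⟨v, hvF, hv⟩ := hC0
    rw [hF] at hvF
    obtain ⟨i, hi, hiv⟩ := Finset.mem_image.mp hvF
    obtain ⟨x, hxK, hx⟩ := hblk i hi
    exact ⟨x, hxK, by rwa [hx, hiv]⟩
  · -- a block-type nucleus with a white coin
    obtain ⟨v, hvF, hv⟩ := hC1
    rw [hF] at hvF
    obtain ⟨i, hi, hiv⟩ := Finset.mem_image.mp hvF
    obtain ⟨x, hxK, hx⟩ := hblk i hi
    exact ⟨x, hxK, by rwa [hx, hiv]⟩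

/-- **Registered stub `stub_densityWhp`** (line `Sketch`, r2 k4, card `poissonised-chessboard`):
the probabilistic input of the chessboard endpoint (`u = 1` end of the leg).  If the free nuclei
have the ZERO intensity and the block-type nuclei are Poisson of intensity `2 · vol`, then for every
bounded window `V` the bad event — a free nucleus is present, or a point of `V` has no block-type
nucleus within plane distance `δ/16` (nuclei read at scale `s(δ)`), or no block-type nucleus has a
black coin, or none has a white coin — has probability `→ 0` as `δ → 0⁺`: by `real_bad_le` with
`N(δ) = ⌈64 Rad/δ⌉₊ + 1 → ∞` and `eventually_exp_mOf_le_cube` it is `O(δ) + 2 · 2^{-N(δ)}`.  (The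
hypothesis `(interior V).Nonempty` is not needed.) [folklore] -/
theorem stub_densityWhp : ∀ (PBf PWf PK : Measure (PointConfig ℂ)),
      IsPoissonPointProcess (0 : Measure ℂ) PBf → IsPoissonPointProcess (0 : Measure ℂ) PWf →
      IsPoissonPointProcess ((2 : ENNReal) • (volume : Measure ℂ)) PK →
      ∀ V : Set ℂ, Bornology.IsBounded V → (interior V).Nonempty →
      Tendsto (fun δ : ℝ => (legMeasure PBf PWf PK).real {ω | ¬ ((ω.1.1.1 : Set ℂ) = ∅ ∧ (ω.1.1.2 : Set ℂ) = ∅ ∧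
          (∀ z ∈ V, ∃ x ∈ (ω.1.2 : Set ℂ), dist z ((sOf δ : ℂ) * x) < δ / 16) ∧
          (∃ x ∈ (ω.1.2 : Set ℂ), blk (mOf δ) x ∈ ω.2) ∧ (∃ x ∈ (ω.1.2 : Set ℂ), blk (mOf δ) x ∉ ω.2))})
        (𝓝[>] 0) (𝓝 0) := by
  intro PBf PWf PK hBf hWf hK V hVb _hVi
  obtain ⟨r, hr⟩ := hVb.subset_closedBall (0 : ℂ)
  have hV : V ⊆ closedBall 0 (max r 1) := hr.trans (closedBall_subset_closedBall (le_max_left _ _))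
  obtain ⟨Nf, hNf⟩ : ∃ Nf : ℝ → ℕ, Nf = fun δ => ⌈max r 1 / (δ / 64)⌉₊ + 1 := ⟨_, rfl⟩
  have hNge : ∀ δ, max r 1 / (δ / 64) + 1 / 2 ≤ (Nf δ : ℝ) := by
    intro δ
    simp only [hNf, Nat.cast_add, Nat.cast_one]
    linarith [Nat.le_ceil (max r 1 / (δ / 64))]
  -- `N(δ) → ∞`, so the coin term `2 · 2^{-N}` vanishes
  have hNtop : Tendsto Nf (𝓝[>] 0) atTop := by
    have h1 : Tendsto (fun δ : ℝ => max r 1 / (δ / 64)) (𝓝[>] 0) atTop := by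
      simp_rw [div_div_eq_mul_div, div_eq_mul_inv]
      exact tendsto_inv_nhdsGT_zero.const_mul_atTop (by positivity)
    rw [hNf]
    exact tendsto_atTop_mono (fun δ => Nat.le_succ _) (tendsto_nat_ceil_atTop.comp h1)
  -- the void term is `O(δ)`
  obtain ⟨C, hC⟩ : ∃ C : ℝ, C = 2 * (128 * max r 1 + 5) ^ 2 := ⟨_, rfl⟩
  have hbound : ∀ᶠ δ in 𝓝[>] (0 : ℝ),
      ((2 * (2 * Nf δ + 1) ^ 2 : ℕ) : ℝ) * Real.exp (-(2 * Real.pi * (mOf δ / 64) ^ 2))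
        ≤ C * δ := by
    filter_upwards [eventually_exp_mOf_le_cube, Ioo_mem_nhdsGT (zero_lt_one : (0 : ℝ) < 1)]
      with δ hexp hδ
    obtain ⟨hδ0, hδ1⟩ := hδ
    have hN2 : 2 * (Nf δ : ℝ) + 1 ≤ (128 * max r 1 + 5) / δ := by
      rw [le_div_iff₀ hδ0]
      simp only [hNf, Nat.cast_add, Nat.cast_one]
      have h1 := Nat.ceil_lt_add_one (by positivity : (0 : ℝ) ≤ max r 1 / (δ / 64))
      have h2 : max r 1 / (δ / 64) * δ = 64 * max r 1 := by
        rw [div_div_eq_mul_div, div_mul_cancel₀ _ hδ0.ne', mul_comm]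
      nlinarith
    have hcast : ((2 * (2 * Nf δ + 1) ^ 2 : ℕ) : ℝ) ≤ 2 * ((128 * max r 1 + 5) / δ) ^ 2 := by
      push_cast
      gcongr
    calc _ ≤ 2 * ((128 * max r 1 + 5) / δ) ^ 2 * δ ^ 3 :=
        mul_le_mul hcast hexp (Real.exp_nonneg _) (by positivity)
      _ = C * δ := by rw [hC]; field_simp
  -- squeeze
  have hg : Tendsto (fun δ => C * δ + 2 * (1 / 2 : ℝ) ^ Nf δ) (𝓝[>] 0) (𝓝 0) := by
    have h1 : Tendsto (fun δ : ℝ => C * δ) (𝓝[>] 0) (𝓝 (C * 0)) :=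
      (tendsto_id.const_mul C).mono_left nhdsWithin_le_nhds
    have h2 := ((tendsto_pow_atTop_nhds_zero_of_lt_one (by norm_num : (0 : ℝ) ≤ 1 / 2)
      (by norm_num)).comp hNtop).const_mul 2
    simpa using h1.add h2
  refine squeeze_zero' (Eventually.of_forall fun δ => measureReal_nonneg) ?_ hg
  filter_upwards [hbound, self_mem_nhdsWithin] with δ hb hδ
  exact (real_bad_le hBf hWf hK hV hδ (hNge δ)).trans (by linarith)

end Summit.CriticalPhenomena.CardyFormulaZ2.Cruxes.SquareFromVoronoiHub.PoissonisedChessboard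

end
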